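import Summits.AtomisticToContinuum.FouriersLaw.Theses.HoelderEscapeProfile
import Summits.AtomisticToContinuum.FouriersLaw.Theorems.CornerNoDip.Negative.FalseWithoutDynamics
import Literature.MathematicalPhysics.KineticTheory.InfiniteChainShiftInvariantUniqueness
import Literature.MathematicalPhysics.KineticTheory.InfiniteChainEnergyDensityMoments
import Literature.MathematicalPhysics.KineticTheory.InfiniteChainGoodSetSymmetries

/-!
# `CornerNoDip` (stmt-AtomisticToContinuum-16009), line `heatprofile`: stub `stub_profileSupBound`

The KINEMATIC SUP BOUND on the Abel heating profile of the infinite pinned quartic chain: in the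
crux's frame (`μ` a shift-invariant Gibbs state of `pinnedChain ω₂ lam β γ` at temperature `T`,
`D` an infinite-volume dynamics preserving `μ`, `h` the split-bond site energy,
`S x t = Cov_μ(h_0, h_x ∘ φ_t)`, `Sb ν x = ν ∫₀^∞ e^{-νt} S x t dt`) there is `M` with
`|Sb ν x| ≤ M` for all `ν > 0` and all sites `x`.

Proof.  With `m = ∫ h_0 dμ`, pointwise `|(h_0 − m)(h_x∘φ_t − m)| ≤ ((h_0 − m)² + (h_x∘φ_t − m)²)/2`;
integrating, `|S x t| ≤ (∫(h_0 − m)² + ∫(h_x − m)²∘φ_t)/2 = ∫ (h_0 − m)² =: M`, using invariance of `μ`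
under `φ_t` (`PreservesMeasure`) and under the lattice translations
(`IsShiftInvariant.measurePreserving_chainShift`, `h_0 ∘ τ_x = h_x`), and square-integrability of
`h_x` (Buttà–Marchioro superstability of every shift-invariant DLR state of the pinned chain,
`hasSuperstabilityEstimate_of_isShiftInvariant_pinnedChain`, and `memLp_energyDensityZ_pinnedChain`).
Then `|Sb ν x| ≤ ν ∫₀^∞ e^{-νt} M dt = M` (`integral_mono_of_nonneg`, which needs no measurability of
`t ↦ S x t`: a junk Bochner value `0` obeys the bound as well; `∫₀^∞ e^{-νt} dt = 1/ν` is the landed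
`CornerNoDip.Negative.integral_exp_neg_mul_Ioi_zero`).
-/

noncomputable section

open Filter Topology Set MeasureTheory Finset

namespace Summit.AtomisticToContinuum.FouriersLaw.Theorems.CornerNoDip.HeatProfile

open Literature.MathematicalPhysics.KineticTheory.HeatConduction

/-- Invariance of the integral under a measure-preserving map, for an a.e.-strongly measurable
integrand: `∫ F ∘ φ dμ = ∫ F dμ`. [folklore] -/
theorem integral_comp_eq_of_measurePreserving {μ : Measure ChainConfig}
    {φ : ChainConfig → ChainConfig} (hφ : MeasurePreserving φ μ μ) {F : ChainConfig → ℝ}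
    (hF : AEStronglyMeasurable F μ) : ∫ σ, F (φ σ) ∂μ = ∫ σ, F σ ∂μ := by
  have hF' : AEStronglyMeasurable F (Measure.map φ μ) := by rw [hφ.map_eq]; exact hF
  rw [← integral_map hφ.measurable.aemeasurable hF', hφ.map_eq]

/-- `t ↦ e^{-νt}` is integrable on `(0, ∞)` for `ν > 0`. [folklore] -/
theorem integrableOn_exp_neg_mul_Ioi {ν : ℝ} (hν : 0 < ν) :
    IntegrableOn (fun t : ℝ => Real.exp (-(ν * t))) (Set.Ioi 0) := by
  have h1 := exp_neg_integrableOn_Ioi 0 hν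
  simp only [neg_mul] at h1
  exact h1

/-- The Abel mean of a function bounded by `M` in absolute value is bounded by `M`:
`|ν ∫₀^∞ e^{-νt} f t dt| ≤ M` (no measurability of `f` needed — the junk value `0` of a
non-integrable Bochner integrand also obeys the bound, since `0 ≤ M` is forced). [folklore] -/
theorem abs_abelMean_le {f : ℝ → ℝ} {M : ℝ} (hf : ∀ t, |f t| ≤ M) {ν : ℝ} (hν : 0 < ν) :
    |ν * ∫ t in Set.Ioi (0:ℝ), Real.exp (-(ν * t)) * f t| ≤ M := by
  have hmajR : IntegrableOn (fun t : ℝ => Real.exp (-(ν * t)) * M) (Set.Ioi 0) :=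
    (integrableOn_exp_neg_mul_Ioi hν).integrable.mul_const M
  have hle : |∫ t in Set.Ioi (0:ℝ), Real.exp (-(ν * t)) * f t| ≤
      ∫ t in Set.Ioi (0:ℝ), Real.exp (-(ν * t)) * M :=
    calc |∫ t in Set.Ioi (0:ℝ), Real.exp (-(ν * t)) * f t|
        ≤ ∫ t in Set.Ioi (0:ℝ), |Real.exp (-(ν * t)) * f t| := abs_integral_le_integral_abs
      _ ≤ ∫ t in Set.Ioi (0:ℝ), Real.exp (-(ν * t)) * M :=
          integral_mono_of_nonneg (Eventually.of_forall fun t => abs_nonneg _) hmajR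
            (Eventually.of_forall fun t => by
              show |Real.exp (-(ν * t)) * f t| ≤ Real.exp (-(ν * t)) * M
              rw [abs_mul, abs_of_pos (Real.exp_pos _)]
              exact mul_le_mul_of_nonneg_left (hf t) (Real.exp_pos _).le)
  rw [abs_mul, abs_of_pos hν]
  calc ν * |∫ t in Set.Ioi (0:ℝ), Real.exp (-(ν * t)) * f t|
      ≤ ν * ∫ t in Set.Ioi (0:ℝ), Real.exp (-(ν * t)) * M := mul_le_mul_of_nonneg_left hle hν.le
    _ = M := by
        rw [integral_mul_const, Negative.integral_exp_neg_mul_Ioi_zero hν, one_div, ← mul_assoc,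
          mul_inv_cancel₀ hν.ne', one_mul]

/-- **Kinematic sup bound on the Abel heating profile** (stub `stub_profileSupBound` of line
`heatprofile` for crux `CornerNoDip`).  In the crux's frame — `ω₂, lam, β > 0`, any `γ`, `T > 0`,
`μ` a `T`-Gibbs state of `pinnedChain ω₂ lam β γ`, shift-invariant and momentum-reversal invariant,
`D : InfiniteChainDynamics` preserving `μ` with shift-covariant flow, `h` the split-bond site energy,
`S x t = Cov_μ(h_0, h_x ∘ φ_t)` the heating profile and `Sb ν x = ν ∫_{(0,∞)} e^{-νt} S x t dt` its
Abel mean — there is `M` with `|Sb ν x| ≤ M` for every `ν > 0` and every `x`.  One may take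
`M = Var_μ(h_0)`: `|S x t| ≤ (‖h_0 − m‖² + ‖(h_x − m)∘φ_t‖²)/2 = Var_μ(h_0)` by AM–GM, invariance of `μ`
under `φ_t` and under the shift, and `h_x ∈ L²(μ)` (superstability of shift-invariant DLR states of
the pinned chain); the Abel mean of a bounded function is bounded by the same constant. [folklore] -/
theorem stub_profileSupBound :
    ∀ ω₂ lam β γ : ℝ, 0 < ω₂ → 0 < lam → 0 < β → ∀ T : ℝ, 0 < T →
      ∀ μ : Measure ChainConfig, (pinnedChain ω₂ lam β γ).IsChainGibbsMeasure T μ → IsShiftInvariant μ →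
        μ.map (fun σ : ChainConfig => fun x : ℤ => ((σ x).1, -(σ x).2)) = μ →
          ∀ D : InfiniteChainDynamics (pinnedChain ω₂ lam β γ), D.PreservesMeasure μ →
            (∀ t : ℝ, ∀ᵐ σ ∂μ, D.flow t (shift σ) = shift (D.flow t σ)) →
              ∀ h : ChainConfig → ℤ → ℝ, h = (fun (σ : ChainConfig) (x : ℤ) =>
                  (σ x).2 ^ 2 / 2 + (pinnedChain ω₂ lam β γ).U (σ x).1 +
                    ((pinnedChain ω₂ lam β γ).V ((σ (x + 1)).1 - (σ x).1) +
                      (pinnedChain ω₂ lam β γ).V ((σ x).1 - (σ (x - 1)).1)) / 2) →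
                ∀ S : ℤ → ℝ → ℝ, S = (fun (x : ℤ) (t : ℝ) =>
                    ∫ σ, (h σ 0 - ∫ σ', h σ' 0 ∂μ) * (h (D.flow t σ) x - ∫ σ', h σ' 0 ∂μ) ∂μ) →
                  ∀ Sb : ℝ → ℤ → ℝ, Sb = (fun (ν : ℝ) (x : ℤ) =>
                      ν * ∫ t in Set.Ioi (0:ℝ), Real.exp (-(ν * t)) * S x t) →
                    ∃ M : ℝ, ∀ ν : ℝ, 0 < ν → ∀ x : ℤ, |Sb ν x| ≤ M := by
  intro ω₂ lam β γ hω hl hβ T hT μ hGibbs hShift _hRev D hPres _hCov h hh S hS Sb hSb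
  haveI := hGibbs.isProbabilityMeasure
  -- the site energy is the Literature energy density `energyDensityZ`
  have hfun : h = fun σ x => (pinnedChain ω₂ lam β γ).energyDensityZ σ x := hh
  have hhx : ∀ σ x, h σ x = (pinnedChain ω₂ lam β γ).energyDensityZ σ x :=
    fun σ x => congrFun (congrFun hfun σ) x
  -- superstability of the shift-invariant Gibbs state, hence `h_x ∈ L²(μ)`
  have hss : (pinnedChain ω₂ lam β γ).HasSuperstabilityEstimate μ :=
    OscillatorChain.hasSuperstabilityEstimate_of_isShiftInvariant_pinnedChain γ hω hl.le hβ.le hT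
      hGibbs hShift
  have hL2 : ∀ x, MemLp (fun σ => h σ x) 2 μ := by
    intro x
    rw [hfun]
    exact OscillatorChain.memLp_energyDensityZ_pinnedChain γ hω.le hl.le hβ.le hss x (by norm_num)
  -- the mean and the centred observables
  obtain ⟨m, hm⟩ : ∃ m : ℝ, m = ∫ σ', h σ' 0 ∂μ := ⟨_, rfl⟩
  have hg : ∀ x, MemLp (fun σ => h σ x - m) 2 μ := fun x => (hL2 x).sub (memLp_const m)
  have hIsq : ∀ x, Integrable (fun σ => (h σ x - m) ^ 2) μ := fun x => (hg x).integrable_sq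
  have hS' : ∀ x t, S x t = ∫ σ, (h σ 0 - m) * (h (D.flow t σ) x - m) ∂μ := fun x t => by
    rw [hm]; exact congrFun (congrFun hS x) t
  have hSb' : ∀ ν x, Sb ν x = ν * ∫ t in Set.Ioi (0:ℝ), Real.exp (-(ν * t)) * S x t :=
    fun ν x => congrFun (congrFun hSb ν) x
  -- invariance of `μ` under the flow: `∫ (h_x − m)² ∘ φ_t = ∫ (h_x − m)²`
  have hflow : ∀ x t, ∫ σ, (h (D.flow t σ) x - m) ^ 2 ∂μ = ∫ σ, (h σ x - m) ^ 2 ∂μ := fun x t =>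
    integral_comp_eq_of_measurePreserving (hPres.2 t) (F := fun σ => (h σ x - m) ^ 2)
      (hIsq x).aestronglyMeasurable
  -- invariance of `μ` under the shift: `∫ (h_x − m)² = ∫ (h_0 − m)²`
  have hshift : ∀ x, ∫ σ, (h σ x - m) ^ 2 ∂μ = ∫ σ, (h σ 0 - m) ^ 2 ∂μ := by
    intro x
    have e : ∀ σ, h (chainShift x σ) 0 = h σ x := fun σ => by
      simp only [hhx, OscillatorChain.energyDensityZ_chainShift, zero_add]
    calc ∫ σ, (h σ x - m) ^ 2 ∂μ = ∫ σ, (h (chainShift x σ) 0 - m) ^ 2 ∂μ := by simp only [e]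
      _ = ∫ σ, (h σ 0 - m) ^ 2 ∂μ :=
          integral_comp_eq_of_measurePreserving (hShift.measurePreserving_chainShift x)
            (F := fun σ => (h σ 0 - m) ^ 2) (hIsq 0).aestronglyMeasurable
  -- the kinematic bound `|S x t| ≤ M := Var_μ(h_0)`
  obtain ⟨M, hM⟩ : ∃ M : ℝ, M = ∫ σ, (h σ 0 - m) ^ 2 ∂μ := ⟨_, rfl⟩
  -- AM–GM: `|a b| ≤ (a² + b²)/2`
  have hpt : ∀ a b : ℝ, |a * b| ≤ (a ^ 2 + b ^ 2) / 2 := fun a b => by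
    rw [abs_mul]
    have h1 := two_mul_le_add_sq |a| |b|
    rw [sq_abs, sq_abs] at h1
    linarith
  have key : ∀ x t, |S x t| ≤ M := by
    intro x t
    have hφ : MeasurePreserving (D.flow t) μ μ := hPres.2 t
    have hIφ : Integrable (fun σ => (h (D.flow t σ) x - m) ^ 2) μ :=
      ((hg x).comp_measurePreserving hφ).integrable_sq
    have hmajI : Integrable (fun σ => ((h σ 0 - m) ^ 2 + (h (D.flow t σ) x - m) ^ 2) / 2) μ :=
      ((hIsq 0).add hIφ).div_const 2
    rw [hS']
    calc |∫ σ, (h σ 0 - m) * (h (D.flow t σ) x - m) ∂μ|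
        ≤ ∫ σ, |(h σ 0 - m) * (h (D.flow t σ) x - m)| ∂μ := abs_integral_le_integral_abs
      _ ≤ ∫ σ, ((h σ 0 - m) ^ 2 + (h (D.flow t σ) x - m) ^ 2) / 2 ∂μ :=
          integral_mono_of_nonneg (Eventually.of_forall fun σ => abs_nonneg _) hmajI
            (Eventually.of_forall fun σ => hpt _ _)
      _ = ((∫ σ, (h σ 0 - m) ^ 2 ∂μ) + ∫ σ, (h (D.flow t σ) x - m) ^ 2 ∂μ) / 2 := by
          rw [integral_div, integral_add (hIsq 0) hIφ]
      _ = M := by rw [hflow x t, hshift x, ← hM]; ring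
  -- the Abel mean of a bounded function is bounded
  refine ⟨M, fun ν hν x => ?_⟩
  rw [hSb']
  exact abs_abelMean_le (key x) hν

end Summit.AtomisticToContinuum.FouriersLaw.Theorems.CornerNoDip.HeatProfile

end
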